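import Literature.Topology.FourManifolds.SurfaceGenusOneTorus
import HarnessLib

/-!
# A closed connected orientable surface with `rank H₁ = 2` is diffeomorphic to `S¹ × S¹`

Topic `Literature/Topology/FourManifolds`; companion of `SurfaceGenusOneTorus.lean` (the
genus-one case of the classification of closed orientable surfaces, Hirsch, *Differential
Topology* (1976), Ch. 9 §3, Thm. 3.5 with Thm. 3.11), written for the fact seat
`provefact-Literature.Topology.FourManifolds.nonempty_diffeomorph_sphere_four_of_sblf_genus_one_noLefschetz`
(Baykur–Kamada 2015, §5, Lemma 11: the genus-one fibres are tori `T² = S¹ × S¹`).  Everything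
here is **proved**; no definition and no named fact is introduced.

`SurfaceGenusOneTorus.lean` proves that any two closed connected orientable smooth surfaces with
`rank_ℤ H₁ = 2` are diffeomorphic.  Here the comparison surface is made CONCRETE: the product
`Circle × Circle` of two copies of Mathlib's Lie group `S¹ ⊆ ℂ` with its product `C^∞` structure
(model `(𝓡 1).prod (𝓡 1)`).  Recharted along a linear isomorphism `ℝ¹ × ℝ¹ ≃L ℝ²`
(`Literature.Geometry.Manifold.Rechart`, Lee 2013 Prop. 1.17) it is a closed connected surface
charted on `ℝ²`, `ℤ`-orientable as a topological group (`isOrientableOver_int_of_isTopologicalGroup`,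
hence smoothly orientable, Bredon VI.7.15 `isOrientable_of_isOrientableOver_int`) with
`H₁ ≅ ℤ²` (from `(ℝ/ℤ)²`, `nonempty_linearEquiv_singularHomology_realTorus_one`), exactly as in
`exists_twoTorus_model` (`ClosedOrientableSurfaces.lean`); and the identity map of the recharted
torus to `Circle × Circle` is a diffeomorphism across the change of model
(`Rechart.contMDiff_out`, `Rechart.contMDiff_into`).

* `nonempty_diffeomorph_circle_prod_circle_of_isOrientable_of_finrank_eq_two` — a closed
  connected orientable smooth surface `S : Type` with `rank_ℤ H₁(S; ℤ) = 2` is diffeomorphic to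
  `Circle × Circle`: `Nonempty (S ≃ₘ⟮𝓡 2, (𝓡 1).prod (𝓡 1)⟯ (Circle × Circle))`;
* `…_of_linearEquiv_fin_two` — the same with the hypothesis in the shape of the SBLF fibre
  clauses, `(Fin (2 * 1) → ℤ) ≃ₗ[ℤ] H₁(S; ℤ)`.

## References

* M. W. Hirsch, *Differential Topology*, GTM 33 (1976), Ch. 9 §3, Thm. 3.5, Thm. 3.11.
  [HirschDT1976]
* J. M. Lee, *Introduction to Smooth Manifolds*, 2nd ed. (2013), Prop. 1.17, Example 15.18.
  [LeeSmoothManifolds2013]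
* R. İ. Baykur, S. Kamada, J. Math. Soc. Japan 67 (2015), §5, Lemma 11. [BaykurKamada2015]
-/

noncomputable section

open scoped Manifold ContDiff Topology
open Set Module
open Literature.AlgebraicTopology.SingularHomology
open Literature.Geometry.Manifold

namespace Literature.Topology.FourManifolds

/-- **A closed connected orientable smooth surface with `rank_ℤ H₁ = 2` is diffeomorphic to the
torus `S¹ × S¹`** (`Circle × Circle` with its product smooth structure), the genus-one case of the
classification of closed orientable surfaces (Hirsch 1976, Ch. 9 §3, Thm. 3.5 with Thm. 3.11).
Proof: `nonempty_diffeomorph_of_isOrientable_of_finrank_eq_two` against the torus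
`Circle × Circle` recharted on `ℝ²` (orientable, `H₁ ≅ ℤ²`, as in `exists_twoTorus_model`),
followed by the recharting diffeomorphism. [cite: HirschDT1976, Ch. 9 §3, Thm. 3.5 and Thm. 3.11] -/
theorem nonempty_diffeomorph_circle_prod_circle_of_isOrientable_of_finrank_eq_two (S : Type)
    [TopologicalSpace S] [T2Space S] [SecondCountableTopology S] [CompactSpace S]
    [ConnectedSpace S] [ChartedSpace (EuclideanSpace ℝ (Fin 2)) S] [IsManifold (𝓡 2) ∞ S]
    (ho : IsOrientable (𝓡 2) S) (h1 : Module.finrank ℤ (singularHomology ℤ ℤ S 1) = 2) :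
    Nonempty (S ≃ₘ⟮𝓡 2, (𝓡 1).prod (𝓡 1)⟯ (Circle × Circle)) := by
  -- the torus `Circle × Circle` recharted on `ℝ²` (as in `exists_twoTorus_model`)
  let L : (EuclideanSpace ℝ (Fin 1) × EuclideanSpace ℝ (Fin 1)) ≃L[ℝ] EuclideanSpace ℝ (Fin 2) :=
    ContinuousLinearEquiv.ofFinrankEq (by simp)
  let f : ModelProd (EuclideanSpace ℝ (Fin 1)) (EuclideanSpace ℝ (Fin 1)) ≃ₜ
      EuclideanSpace ℝ (Fin 2) := L.toHomeomorph
  have hIf : ∀ x, f x = L (((𝓡 1).prod (𝓡 1)) x) := fun x => rfl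
  have hf := Rechart.contMDiff_of_apply_eq_linear (I := (𝓡 1).prod (𝓡 1)) (n := ∞) f L hIf
  have hf' := Rechart.contMDiff_symm_of_apply_eq_linear (I := (𝓡 1).prod (𝓡 1)) (n := ∞) f L hIf
  haveI hT : IsManifold (𝓡 2) ∞ (Rechart f (Circle × Circle)) := Rechart.isManifold f _ hf hf'
  haveI : SecondCountableTopology (Rechart f (Circle × Circle)) :=
    inferInstanceAs (SecondCountableTopology (Circle × Circle))
  haveI : ConnectedSpace (Rechart f (Circle × Circle)) :=
    inferInstanceAs (ConnectedSpace (Circle × Circle))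
  -- orientable: a topological group charted on `ℝ²`
  have hO' := @isOrientableOver_int_of_isTopologicalGroup 2 (Circle × Circle) _ _ _ _
    (Rechart.instChartedSpace f (Circle × Circle))
  have hO : IsOrientableOver ℤ (Rechart f (Circle × Circle)) 2 := hO'
  have hOT : IsOrientable (𝓡 2) (Rechart f (Circle × Circle)) :=
    isOrientable_of_isOrientableOver_int _ hO
  -- `H₁ ≅ ℤ²`: transport from `(ℝ/ℤ)²`
  let eC : AddCircle (1 : ℝ) ≃ₜ Circle := AddCircle.homeomorphCircle one_ne_zero
  let e : (Fin 2 → AddCircle (1 : ℝ)) ≃ₜ Rechart f (Circle × Circle) :=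
    ((Homeomorph.finTwoArrow :
        (Fin 2 → AddCircle (1 : ℝ)) ≃ₜ AddCircle (1 : ℝ) × AddCircle (1 : ℝ)).trans
      (eC.prodCongr eC)).trans
      (Rechart.outHomeomorph f (Circle × Circle)).symm
  obtain ⟨lin⟩ := nonempty_linearEquiv_singularHomology_realTorus_one (Fin 2)
  have hT1 : Module.finrank ℤ (singularHomology ℤ ℤ (Rechart f (Circle × Circle)) 1) = 2 := by
    rw [← (lin.trans (singularHomology.mapIso ℤ ℤ e 1).toLinearEquiv).finrank_eq]
    simp
  -- the classification in genus one, against the recharted torus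
  obtain ⟨Φ⟩ := nonempty_diffeomorph_of_isOrientable_of_finrank_eq_two S
    (Rechart f (Circle × Circle)) ho h1 hOT hT1
  -- the recharting diffeomorphism
  let out : Rechart f (Circle × Circle) ≃ₘ⟮𝓡 2, (𝓡 1).prod (𝓡 1)⟯ (Circle × Circle) :=
    { toEquiv := (Rechart.outHomeomorph f (Circle × Circle)).toEquiv
      contMDiff_toFun := Rechart.contMDiff_out f _ hf hf'
      contMDiff_invFun := Rechart.contMDiff_into f _ hf hf' }
  exact ⟨Φ.trans out⟩

/-- **Oriented genus-one surfaces, in the shape of the SBLF fibre clauses, are diffeomorphic to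
`S¹ × S¹`**: a compact connected orientable `C^∞` surface `S : Type` without boundary with
`(Fin (2 * 1) → ℤ) ≃ₗ[ℤ] H₁(S; ℤ)` — the reading "genus `1`" of the clauses `fibre`,
`exists_higher` of `IsSimplifiedBrokenLefschetzFibration o f L 0` — is diffeomorphic to
`Circle × Circle`; the fibre-identification step "the higher-genus regular fibre is `T²`, so
`X_h ≅ T² × D²`" of the genus-one classification (Baykur–Kamada 2015, §5, Lemma 11; Hayano 2011,
§2.3), granted the orientation of the fibre. [cite: HirschDT1976, Ch. 9 §3, Thm. 3.5 and Thm. 3.11]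
[cite: BaykurKamada2015, §5, Lemma 11] -/
theorem nonempty_diffeomorph_circle_prod_circle_of_isOrientable_of_linearEquiv_fin_two (S : Type)
    [TopologicalSpace S] [T2Space S] [SecondCountableTopology S] [CompactSpace S]
    [ConnectedSpace S] [ChartedSpace (EuclideanSpace ℝ (Fin 2)) S] [IsManifold (𝓡 2) ∞ S]
    (ho : IsOrientable (𝓡 2) S)
    (h1 : Nonempty ((Fin (2 * 1) → ℤ) ≃ₗ[ℤ] singularHomology ℤ ℤ S 1)) :
    Nonempty (S ≃ₘ⟮𝓡 2, (𝓡 1).prod (𝓡 1)⟯ (Circle × Circle)) := by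
  obtain ⟨e⟩ := h1
  refine nonempty_diffeomorph_circle_prod_circle_of_isOrientable_of_finrank_eq_two S ho ?_
  rw [← e.finrank_eq]
  simp

end Literature.Topology.FourManifolds

end
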